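import Literature.Analysis.FunctionSpaces.TorusVectorParseval
import Literature.Analysis.FunctionSpaces.TorusSpectralWeakDerivative
import Literature.Analysis.FunctionSpaces.TorusSobolevNormFacts
import HarnessLib

/-!
# The Peter–Paul inequality for the spectral enstrophy on `T^d`

Function-space support file (everything proved; no definitions, no named facts).  For integrable real vector fields
`a, b` on the flat torus and `δ > 0`, the spectral squared gradient norm `Torus.eGradNormSq` (`4π² ∑_k |k|² ‖𝓕·(k)‖²`,
an extended real) satisfies

  `‖∇a‖₂² ≤ (1 + δ) ‖∇b‖₂² + (1 + δ⁻¹) ‖∇(a − b)‖₂²`      (`Torus.eGradNormSq_le_add_mul_eGradNormSq_sub`),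

termwise on the Fourier side from the elementary `‖x + y‖² ≤ (1 + δ)‖x‖² + (1 + δ⁻¹)‖y‖²` ("Peter–Paul", Evans 2010,
App. B.2 (b), Cauchy's inequality with `ε`).  It is the squared, `ε`-form of the triangle inequality of the `Ḣ¹`
seminorm, in the shape consumed by `limsup` arguments (`‖∇uₙ‖₂² → ‖∇u‖₂²` when `‖∇(uₙ − u)‖₂² → 0`), and the
companion of the tree's `Torus.eGradNormSq_sub_le` (`‖∇(v − w)‖₂² ≤ 2‖∇v‖₂² + 2‖∇w‖₂²`, `NSUniqueness2DParts`).

Tree search (`eGradNormSq_le_add|PeterPaul|eHomSobolevSeminorm_add_le`): only the factor-`2` bound above and the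
inhomogeneous triangle inequality `Torus.eSobolevNorm_add_le_holds`; the homogeneous seminorm has no triangle/Peter–Paul
inequality in the tree.

## References

* L. C. Evans, *Partial Differential Equations*, 2nd ed., AMS (2010), App. B.2 (b). [Evans2010]
-/

noncomputable section

open MeasureTheory Function UnitAddTorus
open scoped ENNReal

namespace Literature.Analysis.FunctionSpaces

namespace Torus

variable {d : Type*} [Fintype d]

/-- **Peter–Paul for the spectral enstrophy**: for integrable `a, b : T^d → ℝ^d` and `δ > 0`,
`‖∇a‖₂² ≤ (1 + δ) ‖∇b‖₂² + (1 + δ⁻¹) ‖∇(a − b)‖₂²` (termwise `‖x + y‖² ≤ (1+δ)‖x‖² + (1+δ⁻¹)‖y‖²` on the Fourier side,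
`x = 𝓕b(k)`, `y = 𝓕(a − b)(k)`; Evans 2010, App. B.2 (b)). [cite: Evans2010, App. B.2 (b)] -/
theorem eGradNormSq_le_add_mul_eGradNormSq_sub {a b : UnitAddTorus d → EuclideanSpace ℝ d}
    (ha : Integrable a volume) (hb : Integrable b volume) {δ : ℝ} (hδ : 0 < δ) :
    eGradNormSq a ≤ ENNReal.ofReal (1 + δ) * eGradNormSq b + ENNReal.ofReal (1 + δ⁻¹) * eGradNormSq (a - b) := by
  classical
  have hab : Integrable (a - b) volume := ha.sub hb
  rw [eGradNormSq_eq_tsum, eGradNormSq_eq_tsum, eGradNormSq_eq_tsum]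
  set C : ℝ≥0∞ := ENNReal.ofReal (4 * Real.pi ^ 2)
  set G : (UnitAddTorus d → EuclideanSpace ℝ d) → (d → ℤ) → ℝ≥0∞ := fun φ k =>
    ENNReal.ofReal (freqNormSq k) * ‖mFourierCoeff (EuclideanSpace.complexify ∘ φ) k‖ₑ ^ 2 with hG
  -- the scalar Peter–Paul inequality, in `ℝ≥0∞`
  have young : ∀ x y : EuclideanSpace ℂ d,
      ‖x + y‖ₑ ^ 2 ≤ ENNReal.ofReal (1 + δ) * ‖x‖ₑ ^ 2 + ENNReal.ofReal (1 + δ⁻¹) * ‖y‖ₑ ^ 2 := by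
    intro x y
    have h : ‖x + y‖ ^ 2 ≤ (1 + δ) * ‖x‖ ^ 2 + (1 + δ⁻¹) * ‖y‖ ^ 2 := by
      have h1 : ‖x + y‖ ≤ ‖x‖ + ‖y‖ := norm_add_le x y
      have h2 : 2 * (‖x‖ * ‖y‖) ≤ δ * ‖x‖ ^ 2 + δ⁻¹ * ‖y‖ ^ 2 := by
        have h3 : 0 ≤ (Real.sqrt δ * ‖x‖ - ‖y‖ / Real.sqrt δ) ^ 2 := sq_nonneg _
        have hs : Real.sqrt δ ^ 2 = δ := Real.sq_sqrt hδ.le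
        have hs0 : 0 < Real.sqrt δ := Real.sqrt_pos.2 hδ
        have e : (Real.sqrt δ * ‖x‖ - ‖y‖ / Real.sqrt δ) ^ 2 =
            Real.sqrt δ ^ 2 * ‖x‖ ^ 2 + (Real.sqrt δ ^ 2)⁻¹ * ‖y‖ ^ 2 - 2 * (‖x‖ * ‖y‖) := by
          field_simp
          ring
        rw [e, hs] at h3
        linarith
      nlinarith [norm_nonneg (x + y), norm_nonneg x, norm_nonneg y]
    have e1 : ∀ w : EuclideanSpace ℂ d, ‖w‖ₑ ^ 2 = ENNReal.ofReal (‖w‖ ^ 2) := fun w => by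
      rw [← ofReal_norm, ← ENNReal.ofReal_pow (norm_nonneg _)]
    rw [e1, e1, e1, ← ENNReal.ofReal_mul (by positivity), ← ENNReal.ofReal_mul (by positivity),
      ← ENNReal.ofReal_add (by positivity) (by positivity)]
    exact ENNReal.ofReal_le_ofReal h
  have hterm : ∀ k, G a k ≤ ENNReal.ofReal (1 + δ) * G b k + ENNReal.ofReal (1 + δ⁻¹) * G (a - b) k := by
    intro k
    simp only [hG]
    have hsplit : mFourierCoeff (EuclideanSpace.complexify ∘ a) k =
        mFourierCoeff (EuclideanSpace.complexify ∘ b) k + mFourierCoeff (EuclideanSpace.complexify ∘ (a - b)) k := by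
      have hpt : (EuclideanSpace.complexify ∘ a : UnitAddTorus d → EuclideanSpace ℂ d) =
          EuclideanSpace.complexify ∘ b + EuclideanSpace.complexify ∘ (a - b) := by
        funext x
        simp only [comp_apply, Pi.add_apply, Pi.sub_apply, ← map_add, add_sub_cancel]
      rw [hpt, mFourierCoeff_add (integrable_complexify_comp hb) (integrable_complexify_comp hab)]
    rw [hsplit, mul_left_comm (ENNReal.ofReal (1 + δ)), mul_left_comm (ENNReal.ofReal (1 + δ⁻¹)), ← mul_add]
    exact mul_le_mul' le_rfl (young _ _)
  calc C * ∑' k, G a k ≤ C * ∑' k, (ENNReal.ofReal (1 + δ) * G b k + ENNReal.ofReal (1 + δ⁻¹) * G (a - b) k) :=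
        mul_le_mul' le_rfl (ENNReal.tsum_le_tsum hterm)
    _ = ENNReal.ofReal (1 + δ) * (C * ∑' k, G b k) + ENNReal.ofReal (1 + δ⁻¹) * (C * ∑' k, G (a - b) k) := by
        rw [ENNReal.tsum_add, ENNReal.tsum_mul_left, ENNReal.tsum_mul_left]; ring

end Torus

end Literature.Analysis.FunctionSpaces

end
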